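/-
Copyright (c) 2026 the pub-hodgecm-mathlib formalisation cell (harness21).  Prover seat hodgecm-mathlib-LH4-p04 (g8), req620 Track A «(D-RAM) FOUR-FRAME» squad
(STAGE-1b, row (2) of the piece `f_{T₊}`, the (β₂) road; dealer∕pen LH4-plan (g13) WORD #108 (4) ∕ WORD #112 (1): «(S4) β₂ ASSEMBLY», LH4-p04 lineage; brick (S4-fibre)), 2026-09-04.
-/
import Summits.HodgeConjecture.HodgeConjecture.Theorems.F0P3cDyRamBlockGlueValueSet   -- ★ p860233 (this lineage): `valueSet_endoGL_sub_one_glued_eq_plane`; brings ★ (E1) `UnitaryLatticeTreeBlockGlueLevel` (levels in plane letters), ★ census DEFS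
import Summits.HodgeConjecture.HodgeConjecture.Theorems.F0P3cDyRamBlockGluePlane      -- ★ (LH4-p07 (g6)): `exists_planeGlueData`, `sub_smul_mem_iff_of_related`, `planeMatrix_injective`; brings ★ T2c, ★ TubeCoordinate, ★ `le_dualLatt_of_isVertexLattice`
import Summits.HodgeConjecture.HodgeConjecture.Theorems.F0P3cDyRamProfileCountCentralRescaling  -- ★ (F0P3a-p05): `latticeInLevel_iff_forall` (reused, not restated)
import HarnessLib

/-!
# Crux `H413`, line LH4 «(D-RAM) FOUR-FRAME» — STAGE-1b, row (2), the (β₂) road, brick (S4-fibre): «THE `f_{T₊}` PREDICATES ARE CONSTANT ON EVERY GLUE FIBRE»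
# two self-dual lattices with the same tube coordinate `b ≥ 1` and the same `W`-part carry the same block levels of `Γ − 1`, `(Γ − 1)²` and — once `|u − 1| ≤ |ϖ^m|` — the same `ϖ^m`-value set

Cell `hodgecm-mathlib` (D-0151), FLOOR 0, crux item H413 = `stmt-HodgeConjecture-24833`, route of record `HCCMUnconditional`; squad F0∕P3c∕LH4; lane
`--supports stmt-HodgeConjecture-24833 --as helper` (count-neutral; pays NO tier-0 row).  THEOREMS ONLY (no `def`, no instance, no notation, no `sorry`, default heartbeats).
DATUM-FREE (`K` valued, `𝒪[K]` a PID, `σ` an isometric involution, `|ϖ| = exp(−1)`, block form `H = !![H₂ 0 0, 0, H₂ 0 1; 0, h, 0; H₂ 1 0, 0, H₂ 1 1]` with `H₂` hermitian of unit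
determinant, `|h| = 1`; no `|2|`, no residue field, no near-`1` hypothesis except `|u − 1| ≤ |ϖ^m|` in §3).

WHY.  ★ p860968 `…BlockGlueLabelledCount.ncard_fixed_selfDual_endoGL_sep_eq_axis_add_sum` (this seat, (S4-glue)) counts the Γ-fixed self-dual lattices carrying a side condition
`Q` through the plane — `#{SD, Γ·M = M, Q M} = #{axis ∧ Q} + Σ_b Σᶠ_{B₂ ∈ S_b ∧ Q̂_b} #fibre` — PROVIDED `Q` is FIBRE-CONSTANT (binder `hQ`: self-dual `M, M′` with the same tube
coordinate `b ≥ 1` and the same `W`-part `M ⊓ ker pr₁` ⇒ `Q M → Q M′`).  The `Q`s of the (β₂) road are the two `f_{T₊}` predicates of ★ census DEFS: the near-transvection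
SHELL `LatticeNearTransvShell ϖ ℓ m (Γ − 1) M` (three block LEVEL tokens `S·M ⊆ ϖ^a·M`, `S ∈ {Γ − 1, (Γ − 1)²}`) and the LABEL (the class of the `ϖ^m`-thickened VALUE SET
`{⟨y, (Γ − 1)y⟩_H ∣ y ∈ M}`).  THIS FILE proves both fibre-constant:
* §0 letters: the block form splits `⟨v, v⟩_H = ⟨pr_W v, pr_W v⟩_{H₂} + σ(v₁)·h·v₁` (`pairing_self_eq_plane_add_line`); hence two INTEGRAL vectors with the same plane part have
  `h`-norm terms congruent mod `𝒪` (`v_line_sub_line_le_one_of_plane_eq` — the one inequality of the file); two plane glue data over one plane lattice are (gen)-RELATED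
  (`exists_related_of_glueData`: `w₀ = t′·w₀′ + a′`, `|t′| ≤ 1`, `a′ ∈ B₂`).
* §1 LEVELS (`forall_mulVec_mem_scaleLattice_iff_of_inf_ker_eq`): for ANY block-at-`1` operator `S` and `c ≠ 0`, `S·M ⊆ c·M ⟺ S·M′ ⊆ c·M′` — ★ (E1)
  `forall_mulVec_mem_scaleLattice_iff_plane` reads both sides as `|S₁₁| ≤ |c| ∧ c⁻¹S_W·B₂ ⊆ B₂ ∧ c⁻¹(S_W − S₁₁)w₀ ∈ B₂`, and the last clause does not see the representative
  (★ `sub_smul_mem_iff_of_related` at `(γ₂, u) := (c⁻¹S_W, c⁻¹S₁₁)`); instances `LatticeInLevel ϖ a (Γ − 1)`, `LatticeInLevel ϖ a ((Γ − 1)²)`, `LatticeNearTransvShell ϖ ℓ m (Γ − 1)`.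
* §2 VALUE SETS (`valueSet_endoGL_sub_one_eq_of_inf_ker_eq`, `|u − 1| ≤ |ϖ^m|`): the `ϖ^m`-thickened value sets of `Γ − 1` on `M` and `M′` COINCIDE.  By ★ p860233 both read
  `{⟨β′, (γ₂ − u)β′⟩ + (u − 1)(⟨β′, β′⟩ + h·N(a·x₀ 1)) ∣ β′ = β + a·w₀}`; re-pairing `(β, a) ↦ (β + a·a′, a·t′)` keeps `β′` and changes the line term by
  `(u − 1)·h·N(a)·(N(x₀ 1) − N(t′·x₀′ 1))`, where `|h·(N(x₀ 1) − N(t′x₀′ 1))| ≤ 1` because `x₀ ∈ M` and `t′·x₀′ + ι_W a′ ∈ M′` are integral vectors with the SAME plane part `w₀`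
  (§0) — so the change is `≤ |u − 1| ≤ |ϖ^m|` and is absorbed by the thickening.  NO plane-dominance and NO smallness of the line term is needed (LH4-p13 (g8)'s ★-cand
  `…GlueLabelPlaneDominated` is the special case of a `ϖ^m`-small line term); this is the theorem behind F0P3-p01 (g36) GLUEFIBRE 91d9b231 «the label is constant on every glue
  fibre, both E¹-classes alike» — MECH-beta2H (M4) is not only numerically but identically dead.
* §3 HEAD — the `hQ` binders of ★ p860968 for the two `f_{T₊}` predicates (`hQ_transvPlus_of_v_sub_one_le`: shell `(ℓ, m)` ∧ value set `= V`; `hQ_cleanMinus_of_v_sub_one_le`: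
  shell `(ℓ, m_c)` ∧ value set `≠ V`, label precision `m`), for ANY reference set `V` (the consumer's `valueSetMod σ ϖ m (xPlus σ ϖ d)`), in p860968's binder shape VERBATIM.
HONEST LABEL.  Count-neutral lattice algebra; nothing printed is asserted; no census law is stated; (β₂) ∕ `betaT2lit` stay HYPOTHESES; `HC_CM` is proved only modulo the 7 printed
citations (2 remaining named inputs: hLiu418 = `stmt-HodgeConjecture-24832`, h413 = `stmt-HodgeConjecture-24833`) until rung 0 closes.
## References
* [Jacobowitz1962] R. Jacobowitz, *Hermitian forms over local fields*, Amer. J. Math. 84 (1962): §4 (dual lattices, gluing of modular components).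
* [BruhatTits1972] F. Bruhat, J. Tits, *Groupes réductifs sur un corps local I*, Publ. Math. IHÉS 41 (1972): §10 (lattice models of the rank-one building; tube layers).
* [Kottwitz1986BaseChangeUnits] R. E. Kottwitz, *Base change for unit elements of Hecke algebras*, Compositio Math. 60 (1986): §1 pp. 240–241.
* [Rogawski1990] J. D. Rogawski, *Automorphic Representations of Unitary Groups in Three Variables*, Ann. of Math. Stud. 123 (1990): §4.8 Case (a) p. 53, §4.9 Prop. 4.9.1 (b) p. 55.
-/

set_option autoImplicit false

noncomputable section

namespace Summit.HodgeConjecture.HodgeConjecture.Cruxes.H413.F0P3cDyRamBlockGlueLabelFibreConstant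

open scoped Valued WithZero Matrix MatrixGroups
open Literature.NumberTheory.Automorphic Literature.NumberTheory.Automorphic.HermitianLattice Literature.NumberTheory.Automorphic.UnitaryLatticeTree
open Literature.NumberTheory.Rogawski1990
open Summit.HodgeConjecture.HodgeConjecture.Cruxes.H413.F0P3cDyRamBlockGluePlane
open Summit.HodgeConjecture.HodgeConjecture.Cruxes.H413.F0P3cDyRamBlockGlueValueSet
open Summit.HodgeConjecture.HodgeConjecture.Cruxes.H413.F0P3cDyRamFourFrameCensusDefs

variable {K : Type*} [Field K] [Valued K ℤᵐ⁰]

/-! ## §0 Letters: the block form splits; integral vectors with the same plane part; related representatives -/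

omit [Valued K ℤᵐ⁰] in
/-- **THE BLOCK FORM SPLITS ON A VECTOR**: `⟨v, v⟩_H = ⟨(v₀, v₂), (v₀, v₂)⟩_{H₂} + σ(v₁)·h·v₁`. [cite: Jacobowitz1962, §4] -/
theorem pairing_self_eq_plane_add_line (σ : K →+* K) (H₂ : Matrix (Fin 2) (Fin 2) K) (h : K) (v : Fin 3 → K) :
    pairing σ (!![H₂ 0 0, 0, H₂ 0 1; 0, h, 0; H₂ 1 0, 0, H₂ 1 1] : Matrix (Fin 3) (Fin 3) K) v v =
      pairing σ H₂ ![v 0, v 2] ![v 0, v 2] + σ (v 1) * h * v 1 := by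
  simp [pairing_apply, Fin.sum_univ_three, Fin.sum_univ_two]
  ring

/-- **TWO INTEGRAL VECTORS WITH THE SAME PLANE PART HAVE CONGRUENT LINE NORMS**: if `v ∈ M`, `v′ ∈ M′` (both self-dual for the block form) and `(v₀, v₂) = (v′₀, v′₂)`, then
`|σ(v₁)·h·v₁ − σ(v′₁)·h·v′₁| ≤ 1` (`⟨v,v⟩, ⟨v′,v′⟩ ∈ 𝒪` and their plane parts coincide). [cite: Jacobowitz1962, §4] [cite: BruhatTits1972, §10] -/
theorem v_line_sub_line_le_one_of_plane_eq (σ : K →+* K) (hvσ : ∀ a, Valued.v (σ a) = Valued.v a) (ϖ : K)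
    (H₂ : Matrix (Fin 2) (Fin 2) K) (h : K) {M M' : Submodule 𝒪[K] (Fin 3 → K)}
    (hM : IsSelfDualLattice σ ϖ (!![H₂ 0 0, 0, H₂ 0 1; 0, h, 0; H₂ 1 0, 0, H₂ 1 1] : Matrix (Fin 3) (Fin 3) K) M)
    (hM' : IsSelfDualLattice σ ϖ (!![H₂ 0 0, 0, H₂ 0 1; 0, h, 0; H₂ 1 0, 0, H₂ 1 1] : Matrix (Fin 3) (Fin 3) K) M')
    {v v' : Fin 3 → K} (hv : v ∈ M) (hv' : v' ∈ M') (h0 : v 0 = v' 0) (h2 : v 2 = v' 2) :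
    Valued.v (σ (v 1) * h * v 1 - σ (v' 1) * h * v' 1) ≤ 1 := by
  set H : Matrix (Fin 3) (Fin 3) K := !![H₂ 0 0, 0, H₂ 0 1; 0, h, 0; H₂ 1 0, 0, H₂ 1 1] with hHdef
  have hA : Valued.v (pairing σ H v v) ≤ 1 := (mem_dualLatt σ H M v).1 (le_dualLatt_of_isVertexLattice hvσ hM hv) v hv
  have hA' : Valued.v (pairing σ H v' v') ≤ 1 := (mem_dualLatt σ H M' v').1 (le_dualLatt_of_isVertexLattice hvσ hM' hv') v' hv'
  have e : σ (v 1) * h * v 1 - σ (v' 1) * h * v' 1 = pairing σ H v v - pairing σ H v' v' := by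
    rw [hHdef, pairing_self_eq_plane_add_line, pairing_self_eq_plane_add_line, h0, h2]; ring
  rw [e]
  exact (Valuation.map_sub _ _ _).trans (max_le hA hA')

/-- **TWO PLANE GLUE DATA OVER ONE PLANE LATTICE ARE RELATED**: if `w₀` satisfies (G1) for `B₂` (`w ∈ B₂ ⟺ w ∈ B₂^♯ ∧ |⟨w₀, w⟩| ≤ 1`) and `w₀′` satisfies (gen) (`B₂^♯ = B₂ + 𝒪w₀′`),
then `w₀ = t′·w₀′ + a′` with `|t′| ≤ 1`, `a′ ∈ B₂` (`w₀ ∈ B₂^♯` by hermitian symmetry). [cite: Jacobowitz1962, §4] -/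
theorem exists_related_of_glueData {σ : K →+* K} (hσ : ∀ a, σ (σ a) = a) (hvσ : ∀ a, Valued.v (σ a) = Valued.v a)
    {H₂ : Matrix (Fin 2) (Fin 2) K} (hH₂σ : (H₂.map σ)ᵀ = H₂) {B₂ : Submodule 𝒪[K] (Fin 2 → K)} {w₀ w₀' : Fin 2 → K}
    (hG1 : ∀ w, w ∈ B₂ ↔ (w ∈ dualLatt σ H₂ B₂ ∧ Valued.v (pairing σ H₂ w₀ w) ≤ 1))
    (hgen' : ∀ w ∈ dualLatt σ H₂ B₂, ∃ (t : K) (a : Fin 2 → K), Valued.v t ≤ 1 ∧ a ∈ B₂ ∧ w = t • w₀' + a) :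
    ∃ (t : K) (a : Fin 2 → K), Valued.v t ≤ 1 ∧ a ∈ B₂ ∧ w₀ = t • w₀' + a := by
  have hH₂h : ∀ a c : Fin 2, σ (H₂ a c) = H₂ c a := fun a c => by
    have e := congrFun (congrFun hH₂σ c) a
    rwa [Matrix.transpose_apply, Matrix.map_apply] at e
  have hsymm₂ : ∀ x y : Fin 2 → K, Valued.v (pairing σ H₂ y x) = Valued.v (pairing σ H₂ x y) := v_pairing_comm_of_hermitian hvσ hσ hH₂h
  have hw₀d : w₀ ∈ dualLatt σ H₂ B₂ := fun y hy => by rw [hsymm₂]; exact ((hG1 y).1 hy).2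
  exact hgen' w₀ hw₀d

/-- The middle-coordinate bound `|x 1|·|ϖ|^b ≤ 1` on a self-dual lattice of tube coordinate `b` (★ `exists_tubeCoordinate` ∘ ★ `tubeCoordinate_unique`). [cite: BruhatTits1972, §10] -/
theorem forall_v_apply_one_mul_le_of_tube (σ : K →+* K) (hvσ : ∀ a, Valued.v (σ a) = Valued.v a) {ϖ : K} (hϖ : Valued.v ϖ = WithZero.exp (-1 : ℤ))
    {H₂ : Matrix (Fin 2) (Fin 2) K} (hH₂ : IsUnit H₂.det) {h : K} (hh : Valued.v h = 1)
    {M : Submodule 𝒪[K] (Fin 3 → K)} (hM : IsSelfDualLattice σ ϖ (!![H₂ 0 0, 0, H₂ 0 1; 0, h, 0; H₂ 1 0, 0, H₂ 1 1] : Matrix (Fin 3) (Fin 3) K) M)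
    {b : ℕ} (hb : ∀ c : K, (Pi.single 1 c : Fin 3 → K) ∈ M ↔ Valued.v c ≤ Valued.v ϖ ^ b) :
    ∀ x ∈ M, Valued.v (x 1) * Valued.v ϖ ^ b ≤ 1 := by
  obtain ⟨b', hb', hpr', -⟩ := exists_tubeCoordinate σ hvσ hϖ hH₂ hh hM
  obtain ⟨hbb, -⟩ := tubeCoordinate_unique hϖ hb hb'
  subst hbb
  exact hpr'

/-- The depth clause of a block level token does not depend on the representative: for `c⁻¹A·B₂ ⊆ B₂`, `|c⁻¹s| ≤ 1` and (gen)-related `w₀, w₀′`,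
`c⁻¹(A w₀ − s·w₀) ∈ B₂ ⟺ c⁻¹(A w₀′ − s·w₀′) ∈ B₂` (★ `sub_smul_mem_iff_of_related` at `(γ₂, u) := (c⁻¹A, c⁻¹s)`). [cite: Jacobowitz1962, §4] -/
theorem smul_sub_smul_mem_iff_of_related {B₂ : Submodule 𝒪[K] (Fin 2 → K)} {A : Matrix (Fin 2) (Fin 2) K} {c s : K}
    (hst : ∀ y ∈ B₂, c⁻¹ • (A *ᵥ y) ∈ B₂) (hs : Valued.v (c⁻¹ * s) ≤ 1) {w₀ w₀' : Fin 2 → K}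
    (h₁ : ∃ (t : K) (a : Fin 2 → K), Valued.v t ≤ 1 ∧ a ∈ B₂ ∧ w₀' = t • w₀ + a)
    (h₂ : ∃ (t : K) (a : Fin 2 → K), Valued.v t ≤ 1 ∧ a ∈ B₂ ∧ w₀ = t • w₀' + a) :
    c⁻¹ • (A *ᵥ w₀ - s • w₀) ∈ B₂ ↔ c⁻¹ • (A *ᵥ w₀' - s • w₀') ∈ B₂ := by
  have e : ∀ w : Fin 2 → K, c⁻¹ • (A *ᵥ w - s • w) = (c⁻¹ • A) *ᵥ w - (c⁻¹ * s) • w := fun w => by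
    rw [Matrix.smul_mulVec, smul_sub, smul_smul]
  rw [e, e]
  exact sub_smul_mem_iff_of_related (fun y hy => by rw [Matrix.smul_mulVec]; exact hst y hy) hs h₁ h₂

/-! ## §1 Levels: every block level token is constant on the glue fibres -/

/-- **BLOCK LEVELS ARE FIBRE-CONSTANT.**  `S` block at `1` (column `1` = `S₁₁·e₁`, row `1` zero off the diagonal), `c ≠ 0`; `M, M′` self-dual for the block form with the same
tube coordinate `b ≥ 1` and the same `W`-part.  Then `(∀ x ∈ M, S x ∈ c·M) ⟺ (∀ x ∈ M′, S x ∈ c·M′)`. [cite: Kottwitz1986BaseChangeUnits, §1 pp. 240–241] [cite: BruhatTits1972, §10] [cite: Jacobowitz1962, §4] -/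
theorem forall_mulVec_mem_scaleLattice_iff_of_inf_ker_eq [IsPrincipalIdealRing 𝒪[K]] (σ : K →+* K) (hσ : ∀ a, σ (σ a) = a)
    (hvσ : ∀ a, Valued.v (σ a) = Valued.v a) {ϖ : K} (hϖ : Valued.v ϖ = WithZero.exp (-1 : ℤ))
    {H₂ : Matrix (Fin 2) (Fin 2) K} (hH₂ : IsUnit H₂.det) (hH₂σ : (H₂.map σ)ᵀ = H₂) {h : K} (hh : Valued.v h = 1)
    {S : Matrix (Fin 3) (Fin 3) K} (hcol : ∀ l, l ≠ 1 → S l 1 = 0) (hrow : ∀ l, l ≠ 1 → S 1 l = 0) {c : K} (hc : c ≠ 0)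
    {M M' : Submodule 𝒪[K] (Fin 3 → K)}
    (hM : IsSelfDualLattice σ ϖ (!![H₂ 0 0, 0, H₂ 0 1; 0, h, 0; H₂ 1 0, 0, H₂ 1 1] : Matrix (Fin 3) (Fin 3) K) M)
    (hM' : IsSelfDualLattice σ ϖ (!![H₂ 0 0, 0, H₂ 0 1; 0, h, 0; H₂ 1 0, 0, H₂ 1 1] : Matrix (Fin 3) (Fin 3) K) M')
    {b : ℕ} (hb1 : 1 ≤ b) (hb : ∀ a : K, (Pi.single 1 a : Fin 3 → K) ∈ M ↔ Valued.v a ≤ Valued.v ϖ ^ b)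
    (hb' : ∀ a : K, (Pi.single 1 a : Fin 3 → K) ∈ M' ↔ Valued.v a ≤ Valued.v ϖ ^ b)
    (hW : M ⊓ LinearMap.ker ((LinearMap.proj (1 : Fin 3) : (Fin 3 → K) →ₗ[K] K).restrictScalars 𝒪[K]) =
      M' ⊓ LinearMap.ker ((LinearMap.proj (1 : Fin 3) : (Fin 3 → K) →ₗ[K] K).restrictScalars 𝒪[K])) :
    (∀ x ∈ M, S *ᵥ x ∈ scaleLattice c M) ↔ (∀ x ∈ M', S *ᵥ x ∈ scaleLattice c M') := by
  obtain ⟨B₂, w₀, x₀, -, hB, hx₀, hx₀1, hprx, hG1, hgen, -⟩ := exists_planeGlueData σ hσ hvσ hϖ hH₂ hH₂σ hh hM hb1 hb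
  obtain ⟨B₂', w₀', x₀', -, hB', hx₀', hx₀'1, hprx', hG1', hgen', -⟩ := exists_planeGlueData σ hσ hvσ hϖ hH₂ hH₂σ hh hM' hb1 hb'
  have hBB : B₂' = B₂ := Submodule.map_injective_of_injective planeMatrix_injective (by rw [hB', hB, hW])
  subst hBB
  have hpr := forall_v_apply_one_mul_le_of_tube σ hvσ hϖ hH₂ hh hM hb
  have hpr' := forall_v_apply_one_mul_le_of_tube σ hvσ hϖ hH₂ hh hM' hb'
  rw [forall_mulVec_mem_scaleLattice_iff_plane hϖ hcol hrow hc hb hpr hB hx₀ hx₀1 hprx,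
    forall_mulVec_mem_scaleLattice_iff_plane hϖ hcol hrow hc hb' hpr' hB' hx₀' hx₀'1 hprx']
  refine and_congr_right fun h1 => and_congr_right fun h2 => ?_
  have hs : Valued.v (c⁻¹ * S 1 1) ≤ 1 := by
    have hvc : Valued.v c ≠ 0 := (Valuation.ne_zero_iff _).2 hc
    rw [map_mul, map_inv₀]
    calc (Valued.v c)⁻¹ * Valued.v (S 1 1) ≤ (Valued.v c)⁻¹ * Valued.v c := mul_le_mul_right h1 _
      _ = 1 := inv_mul_cancel₀ hvc
  exact smul_sub_smul_mem_iff_of_related h2 hs (exists_related_of_glueData hσ hvσ hH₂σ hG1' hgen) (exists_related_of_glueData hσ hvσ hH₂σ hG1 hgen')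

/-- **`LatticeInLevel ϖ a (Γ − 1)` IS FIBRE-CONSTANT** (§1 at `S := Γ − 1`, `c := ϖ^a`). [cite: Kottwitz1986BaseChangeUnits, §1 pp. 240–241] [cite: BruhatTits1972, §10] -/
theorem latticeInLevel_endoGL_sub_one_iff_of_inf_ker_eq [IsPrincipalIdealRing 𝒪[K]] (σ : K →+* K) (hσ : ∀ a, σ (σ a) = a)
    (hvσ : ∀ a, Valued.v (σ a) = Valued.v a) {ϖ : K} (hϖ : Valued.v ϖ = WithZero.exp (-1 : ℤ))
    {H₂ : Matrix (Fin 2) (Fin 2) K} (hH₂ : IsUnit H₂.det) (hH₂σ : (H₂.map σ)ᵀ = H₂) {h : K} (hh : Valued.v h = 1)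
    (γ₂ : GL (Fin 2) K) (u : GL (Fin 1) K) (a : ℕ) {M M' : Submodule 𝒪[K] (Fin 3 → K)}
    (hM : IsSelfDualLattice σ ϖ (!![H₂ 0 0, 0, H₂ 0 1; 0, h, 0; H₂ 1 0, 0, H₂ 1 1] : Matrix (Fin 3) (Fin 3) K) M)
    (hM' : IsSelfDualLattice σ ϖ (!![H₂ 0 0, 0, H₂ 0 1; 0, h, 0; H₂ 1 0, 0, H₂ 1 1] : Matrix (Fin 3) (Fin 3) K) M')
    {b : ℕ} (hb1 : 1 ≤ b) (hb : ∀ c : K, (Pi.single 1 c : Fin 3 → K) ∈ M ↔ Valued.v c ≤ Valued.v ϖ ^ b)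
    (hb' : ∀ c : K, (Pi.single 1 c : Fin 3 → K) ∈ M' ↔ Valued.v c ≤ Valued.v ϖ ^ b)
    (hW : M ⊓ LinearMap.ker ((LinearMap.proj (1 : Fin 3) : (Fin 3 → K) →ₗ[K] K).restrictScalars 𝒪[K]) =
      M' ⊓ LinearMap.ker ((LinearMap.proj (1 : Fin 3) : (Fin 3 → K) →ₗ[K] K).restrictScalars 𝒪[K])) :
    LatticeInLevel ϖ a ((((endoGL (γ₂, u) : GL (Fin 3) K) : Matrix (Fin 3) (Fin 3) K) - 1)) M ↔
      LatticeInLevel ϖ a ((((endoGL (γ₂, u) : GL (Fin 3) K) : Matrix (Fin 3) (Fin 3) K) - 1)) M' := by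
  have hϖ0 : ϖ ≠ 0 := fun h0 => by rw [h0, map_zero] at hϖ; exact WithZero.coe_ne_zero hϖ.symm
  rw [F0P3cDyRamProfileCountCentralRescaling.latticeInLevel_iff_forall, F0P3cDyRamProfileCountCentralRescaling.latticeInLevel_iff_forall]
  exact forall_mulVec_mem_scaleLattice_iff_of_inf_ker_eq σ hσ hvσ hϖ hH₂ hH₂σ hh (endoGL_sub_one_col γ₂ u) (endoGL_sub_one_row γ₂ u) (pow_ne_zero a hϖ0)
    hM hM' hb1 hb hb' hW

/-- **`LatticeInLevel ϖ a ((Γ − 1)²)` IS FIBRE-CONSTANT** (§1 at `S := (Γ − 1)²`, `c := ϖ^a`). [cite: Kottwitz1986BaseChangeUnits, §1 pp. 240–241] [cite: BruhatTits1972, §10] -/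
theorem latticeInLevel_endoGL_sub_one_sq_iff_of_inf_ker_eq [IsPrincipalIdealRing 𝒪[K]] (σ : K →+* K) (hσ : ∀ a, σ (σ a) = a)
    (hvσ : ∀ a, Valued.v (σ a) = Valued.v a) {ϖ : K} (hϖ : Valued.v ϖ = WithZero.exp (-1 : ℤ))
    {H₂ : Matrix (Fin 2) (Fin 2) K} (hH₂ : IsUnit H₂.det) (hH₂σ : (H₂.map σ)ᵀ = H₂) {h : K} (hh : Valued.v h = 1)
    (γ₂ : GL (Fin 2) K) (u : GL (Fin 1) K) (a : ℕ) {M M' : Submodule 𝒪[K] (Fin 3 → K)}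
    (hM : IsSelfDualLattice σ ϖ (!![H₂ 0 0, 0, H₂ 0 1; 0, h, 0; H₂ 1 0, 0, H₂ 1 1] : Matrix (Fin 3) (Fin 3) K) M)
    (hM' : IsSelfDualLattice σ ϖ (!![H₂ 0 0, 0, H₂ 0 1; 0, h, 0; H₂ 1 0, 0, H₂ 1 1] : Matrix (Fin 3) (Fin 3) K) M')
    {b : ℕ} (hb1 : 1 ≤ b) (hb : ∀ c : K, (Pi.single 1 c : Fin 3 → K) ∈ M ↔ Valued.v c ≤ Valued.v ϖ ^ b)
    (hb' : ∀ c : K, (Pi.single 1 c : Fin 3 → K) ∈ M' ↔ Valued.v c ≤ Valued.v ϖ ^ b)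
    (hW : M ⊓ LinearMap.ker ((LinearMap.proj (1 : Fin 3) : (Fin 3 → K) →ₗ[K] K).restrictScalars 𝒪[K]) =
      M' ⊓ LinearMap.ker ((LinearMap.proj (1 : Fin 3) : (Fin 3 → K) →ₗ[K] K).restrictScalars 𝒪[K])) :
    LatticeInLevel ϖ a ((((endoGL (γ₂, u) : GL (Fin 3) K) : Matrix (Fin 3) (Fin 3) K) - 1) * ((((endoGL (γ₂, u) : GL (Fin 3) K) : Matrix (Fin 3) (Fin 3) K) - 1))) M ↔
      LatticeInLevel ϖ a ((((endoGL (γ₂, u) : GL (Fin 3) K) : Matrix (Fin 3) (Fin 3) K) - 1) * ((((endoGL (γ₂, u) : GL (Fin 3) K) : Matrix (Fin 3) (Fin 3) K) - 1))) M' := by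
  have hϖ0 : ϖ ≠ 0 := fun h0 => by rw [h0, map_zero] at hϖ; exact WithZero.coe_ne_zero hϖ.symm
  obtain ⟨hcol2, -⟩ := endoGL_sub_one_sq_col γ₂ u
  rw [F0P3cDyRamProfileCountCentralRescaling.latticeInLevel_iff_forall, F0P3cDyRamProfileCountCentralRescaling.latticeInLevel_iff_forall]
  exact forall_mulVec_mem_scaleLattice_iff_of_inf_ker_eq σ hσ hvσ hϖ hH₂ hH₂σ hh hcol2 (endoGL_sub_one_sq_row γ₂ u) (pow_ne_zero a hϖ0) hM hM' hb1 hb hb' hW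

/-- **THE NEAR-TRANSVECTION SHELL IS FIBRE-CONSTANT**: `LatticeNearTransvShell ϖ ℓ m (Γ − 1) M ↔ LatticeNearTransvShell ϖ ℓ m (Γ − 1) M′`. [cite: Kottwitz1986BaseChangeUnits, §1 pp. 240–241] [cite: BruhatTits1972, §10] -/
theorem latticeNearTransvShell_iff_of_inf_ker_eq [IsPrincipalIdealRing 𝒪[K]] (σ : K →+* K) (hσ : ∀ a, σ (σ a) = a)
    (hvσ : ∀ a, Valued.v (σ a) = Valued.v a) {ϖ : K} (hϖ : Valued.v ϖ = WithZero.exp (-1 : ℤ))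
    {H₂ : Matrix (Fin 2) (Fin 2) K} (hH₂ : IsUnit H₂.det) (hH₂σ : (H₂.map σ)ᵀ = H₂) {h : K} (hh : Valued.v h = 1)
    (γ₂ : GL (Fin 2) K) (u : GL (Fin 1) K) (ℓ m : ℕ) {M M' : Submodule 𝒪[K] (Fin 3 → K)}
    (hM : IsSelfDualLattice σ ϖ (!![H₂ 0 0, 0, H₂ 0 1; 0, h, 0; H₂ 1 0, 0, H₂ 1 1] : Matrix (Fin 3) (Fin 3) K) M)
    (hM' : IsSelfDualLattice σ ϖ (!![H₂ 0 0, 0, H₂ 0 1; 0, h, 0; H₂ 1 0, 0, H₂ 1 1] : Matrix (Fin 3) (Fin 3) K) M')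
    {b : ℕ} (hb1 : 1 ≤ b) (hb : ∀ c : K, (Pi.single 1 c : Fin 3 → K) ∈ M ↔ Valued.v c ≤ Valued.v ϖ ^ b)
    (hb' : ∀ c : K, (Pi.single 1 c : Fin 3 → K) ∈ M' ↔ Valued.v c ≤ Valued.v ϖ ^ b)
    (hW : M ⊓ LinearMap.ker ((LinearMap.proj (1 : Fin 3) : (Fin 3 → K) →ₗ[K] K).restrictScalars 𝒪[K]) =
      M' ⊓ LinearMap.ker ((LinearMap.proj (1 : Fin 3) : (Fin 3 → K) →ₗ[K] K).restrictScalars 𝒪[K])) :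
    LatticeNearTransvShell ϖ ℓ m ((((endoGL (γ₂, u) : GL (Fin 3) K) : Matrix (Fin 3) (Fin 3) K) - 1)) M ↔
      LatticeNearTransvShell ϖ ℓ m ((((endoGL (γ₂, u) : GL (Fin 3) K) : Matrix (Fin 3) (Fin 3) K) - 1)) M' := by
  unfold LatticeNearTransvShell
  rw [latticeInLevel_endoGL_sub_one_iff_of_inf_ker_eq σ hσ hvσ hϖ hH₂ hH₂σ hh γ₂ u ℓ hM hM' hb1 hb hb' hW,
    latticeInLevel_endoGL_sub_one_iff_of_inf_ker_eq σ hσ hvσ hϖ hH₂ hH₂σ hh γ₂ u (ℓ + 1) hM hM' hb1 hb hb' hW,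
    latticeInLevel_endoGL_sub_one_sq_iff_of_inf_ker_eq σ hσ hvσ hϖ hH₂ hH₂σ hh γ₂ u m hM hM' hb1 hb hb' hW]

/-! ## §2 Value sets: the `ϖ^m`-thickened value set of `Γ − 1` is constant on the glue fibres once `|u − 1| ≤ |ϖ^m|` -/

/-- One inclusion of §2 on explicit plane glue data: `(B₂, w₀, x₀)` for `M`, `(B₂, w₀′, x₀′)` for `M′`, related by `w₀ = t′·w₀′ + a′`; `|u − 1| ≤ |ϖ^m|`.
The value of `(β, a)` on `M` is the value of `(β + a·a′, a·t′)` on `M′` up to `(u − 1)·h·N(a)·(N(x₀ 1) − N(t′x₀′ 1))`, of size `≤ |u − 1|` (§0). [cite: Jacobowitz1962, §4] [cite: Rogawski1990, §4.9 Prop. 4.9.1 (b) p. 55] -/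
theorem valueSet_endoGL_sub_one_subset_of_related (σ : K →+* K) (hvσ : ∀ a, Valued.v (σ a) = Valued.v a) {ϖ : K} (hϖ : Valued.v ϖ = WithZero.exp (-1 : ℤ))
    (H₂ : Matrix (Fin 2) (Fin 2) K) (h : K) {M M' : Submodule 𝒪[K] (Fin 3 → K)}
    (hM : IsSelfDualLattice σ ϖ (!![H₂ 0 0, 0, H₂ 0 1; 0, h, 0; H₂ 1 0, 0, H₂ 1 1] : Matrix (Fin 3) (Fin 3) K) M)
    (hM' : IsSelfDualLattice σ ϖ (!![H₂ 0 0, 0, H₂ 0 1; 0, h, 0; H₂ 1 0, 0, H₂ 1 1] : Matrix (Fin 3) (Fin 3) K) M')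
    {b : ℕ} (hpr : ∀ x ∈ M, Valued.v (x 1) * Valued.v ϖ ^ b ≤ 1) (hpr' : ∀ x ∈ M', Valued.v (x 1) * Valued.v ϖ ^ b ≤ 1)
    {B₂ : Submodule 𝒪[K] (Fin 2 → K)} {w₀ w₀' : Fin 2 → K} {x₀ x₀' : Fin 3 → K}
    (hB : B₂.map ((Matrix.toLin' (!![1, 0; 0, 0; 0, 1] : Matrix (Fin 3) (Fin 2) K)).restrictScalars 𝒪[K]) =
      M ⊓ LinearMap.ker ((LinearMap.proj (1 : Fin 3) : (Fin 3 → K) →ₗ[K] K).restrictScalars 𝒪[K]))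
    (hB' : B₂.map ((Matrix.toLin' (!![1, 0; 0, 0; 0, 1] : Matrix (Fin 3) (Fin 2) K)).restrictScalars 𝒪[K]) =
      M' ⊓ LinearMap.ker ((LinearMap.proj (1 : Fin 3) : (Fin 3 → K) →ₗ[K] K).restrictScalars 𝒪[K]))
    (hx₀ : x₀ ∈ M) (hx₀1 : Valued.v (x₀ 1) * Valued.v ϖ ^ b = 1) (hprx : x₀ - Pi.single 1 (x₀ 1) = ![w₀ 0, 0, w₀ 1])
    (hx₀' : x₀' ∈ M') (hx₀'1 : Valued.v (x₀' 1) * Valued.v ϖ ^ b = 1) (hprx' : x₀' - Pi.single 1 (x₀' 1) = ![w₀' 0, 0, w₀' 1])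
    {t' : K} {a' : Fin 2 → K} (ht' : Valued.v t' ≤ 1) (ha' : a' ∈ B₂) (hw : w₀ = t' • w₀' + a')
    (γ₂ : GL (Fin 2) K) (u : GL (Fin 1) K) {m : ℕ} (hum : Valued.v ((u : Matrix (Fin 1) (Fin 1) K) 0 0 - 1) ≤ Valued.v (ϖ ^ m)) :
    {z : K | ∃ y ∈ M, Valued.v ((ϖ ^ m)⁻¹ * (z - pairing σ (!![H₂ 0 0, 0, H₂ 0 1; 0, h, 0; H₂ 1 0, 0, H₂ 1 1] : Matrix (Fin 3) (Fin 3) K) y ((((endoGL (γ₂, u) : GL (Fin 3) K) : Matrix (Fin 3) (Fin 3) K) - 1) *ᵥ y))) ≤ 1} ⊆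
      {z : K | ∃ y ∈ M', Valued.v ((ϖ ^ m)⁻¹ * (z - pairing σ (!![H₂ 0 0, 0, H₂ 0 1; 0, h, 0; H₂ 1 0, 0, H₂ 1 1] : Matrix (Fin 3) (Fin 3) K) y ((((endoGL (γ₂, u) : GL (Fin 3) K) : Matrix (Fin 3) (Fin 3) K) - 1) *ᵥ y))) ≤ 1} := by
  have hϖ0 : ϖ ≠ 0 := fun h0 => by rw [h0, map_zero] at hϖ; exact WithZero.coe_ne_zero hϖ.symm
  have hϖm0 : Valued.v (ϖ ^ m) ≠ 0 := (Valuation.ne_zero_iff _).2 (pow_ne_zero m hϖ0)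
  rw [valueSet_endoGL_sub_one_glued_eq_plane σ hϖ H₂ h hpr hB hx₀ hx₀1 hprx γ₂ u m, valueSet_endoGL_sub_one_glued_eq_plane σ hϖ H₂ h hpr' hB' hx₀' hx₀'1 hprx' γ₂ u m]
  rintro z ⟨β, hβ, a, ha, hv⟩
  -- the integral vector of `M′` with plane part `w₀`: `t′·x₀′ + ι_W a′`
  have ha'M : (![a' 0, 0, a' 1] : Fin 3 → K) ∈ M' := by
    have hmem : (![a' 0, 0, a' 1] : Fin 3 → K) ∈ B₂.map ((Matrix.toLin' (!![1, 0; 0, 0; 0, 1] : Matrix (Fin 3) (Fin 2) K)).restrictScalars 𝒪[K]) := by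
      rw [mem_map_planeMatrix_iff]
      have ea : (![(![a' 0, 0, a' 1] : Fin 3 → K) 0, (![a' 0, 0, a' 1] : Fin 3 → K) 2] : Fin 2 → K) = a' := by
        ext i; fin_cases i <;> rfl
      exact ⟨rfl, by rw [ea]; exact ha'⟩
    rw [hB'] at hmem
    exact (Submodule.mem_inf.1 hmem).1
  set v' : Fin 3 → K := t' • x₀' + ![a' 0, 0, a' 1] with hv'def
  have hv'M : v' ∈ M' := M'.add_mem (M'.smul_mem (⟨t', (Valuation.mem_integer_iff _ _).2 ht'⟩ : 𝒪[K]) hx₀') ha'M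
  have hx0 : x₀ 0 = w₀ 0 := by have e := congrFun hprx 0; simpa using e
  have hx2 : x₀ 2 = w₀ 1 := by have e := congrFun hprx 2; simpa using e
  have hx0' : x₀' 0 = w₀' 0 := by have e := congrFun hprx' 0; simpa using e
  have hx2' : x₀' 2 = w₀' 1 := by have e := congrFun hprx' 2; simpa using e
  have hv'0e : v' 0 = t' * x₀' 0 + a' 0 := by
    rw [hv'def, Pi.add_apply, Pi.smul_apply, smul_eq_mul]; rfl
  have hv'2e : v' 2 = t' * x₀' 2 + a' 1 := by
    rw [hv'def, Pi.add_apply, Pi.smul_apply, smul_eq_mul]; rfl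
  have hv'1 : v' 1 = t' * x₀' 1 := by
    rw [hv'def, Pi.add_apply, Pi.smul_apply, smul_eq_mul]
    show t' * x₀' 1 + 0 = t' * x₀' 1
    rw [add_zero]
  have hv'0 : x₀ 0 = v' 0 := by
    have e := congrFun hw 0
    simp only [Pi.add_apply, Pi.smul_apply, smul_eq_mul] at e
    rw [hv'0e, hx0, hx0', e]
  have hv'2 : x₀ 2 = v' 2 := by
    have e := congrFun hw 1
    simp only [Pi.add_apply, Pi.smul_apply, smul_eq_mul] at e
    rw [hv'2e, hx2, hx2', e]
  -- the key congruence of the two line norms (§0)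
  have hkey : Valued.v (σ (x₀ 1) * h * x₀ 1 - σ (t' * x₀' 1) * h * (t' * x₀' 1)) ≤ 1 := by
    have k := v_line_sub_line_le_one_of_plane_eq σ hvσ ϖ H₂ h hM hM' hx₀ hv'M hv'0 hv'2
    rwa [hv'1] at k
  -- re-pair `(β, a) ↦ (β + a·a′, a·t′)`: the same `β′`
  have hplane : β + a • a' + (a * t') • w₀' = β + a • w₀ := by
    rw [hw, smul_add, ← smul_smul]; abel
  refine ⟨β + a • a', B₂.add_mem hβ (B₂.smul_mem (⟨a, (Valuation.mem_integer_iff _ _).2 ha⟩ : 𝒪[K]) ha'), a * t', ?_, ?_⟩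
  · rw [map_mul]; exact mul_le_one' ha ht'
  rw [hplane]
  -- the two values differ by `(u − 1)·h·N(a)·(N(x₀ 1) − N(t′x₀′ 1))`, of size `≤ |u − 1| ≤ |ϖ^m|`
  set P : K := pairing σ H₂ (β + a • w₀) ((((γ₂ : Matrix (Fin 2) (Fin 2) K) - (u : Matrix (Fin 1) (Fin 1) K) 0 0 • (1 : Matrix (Fin 2) (Fin 2) K))) *ᵥ (β + a • w₀)) +
      ((u : Matrix (Fin 1) (Fin 1) K) 0 0 - 1) * (pairing σ H₂ (β + a • w₀) (β + a • w₀) + σ (a * x₀ 1) * h * (a * x₀ 1)) with hP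
  set P' : K := pairing σ H₂ (β + a • w₀) ((((γ₂ : Matrix (Fin 2) (Fin 2) K) - (u : Matrix (Fin 1) (Fin 1) K) 0 0 • (1 : Matrix (Fin 2) (Fin 2) K))) *ᵥ (β + a • w₀)) +
      ((u : Matrix (Fin 1) (Fin 1) K) 0 0 - 1) * (pairing σ H₂ (β + a • w₀) (β + a • w₀) + σ (a * t' * x₀' 1) * h * (a * t' * x₀' 1)) with hP'
  have hdiff : P - P' = ((u : Matrix (Fin 1) (Fin 1) K) 0 0 - 1) * (σ a * a) * (σ (x₀ 1) * h * x₀ 1 - σ (t' * x₀' 1) * h * (t' * x₀' 1)) := by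
    rw [hP, hP']; simp only [map_mul]; ring
  have hvdiff : Valued.v (P - P') ≤ Valued.v (ϖ ^ m) := by
    rw [hdiff, map_mul, map_mul, map_mul, hvσ]
    calc Valued.v ((u : Matrix (Fin 1) (Fin 1) K) 0 0 - 1) * (Valued.v a * Valued.v a) * Valued.v (σ (x₀ 1) * h * x₀ 1 - σ (t' * x₀' 1) * h * (t' * x₀' 1))
        ≤ Valued.v (ϖ ^ m) * (1 * 1) * 1 := by gcongr
      _ = Valued.v (ϖ ^ m) := by rw [mul_one, mul_one, mul_one]
  have e : (ϖ ^ m)⁻¹ * (z - P') = (ϖ ^ m)⁻¹ * (z - P) + (ϖ ^ m)⁻¹ * (P - P') := by ring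
  show Valued.v ((ϖ ^ m)⁻¹ * (z - P')) ≤ 1
  rw [e]
  refine (Valuation.map_add _ _ _).trans (max_le hv ?_)
  rw [map_mul, map_inv₀]
  calc (Valued.v (ϖ ^ m))⁻¹ * Valued.v (P - P') ≤ (Valued.v (ϖ ^ m))⁻¹ * Valued.v (ϖ ^ m) := mul_le_mul_right hvdiff _
    _ = 1 := inv_mul_cancel₀ hϖm0

/-- **THE VALUE SET IS FIBRE-CONSTANT.**  `Γ = ι(γ₂, u)` with `|u − 1| ≤ |ϖ^m|`; `M, M′` self-dual for the block form with the same tube coordinate `b ≥ 1` and the same `W`-part.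
Then the `ϖ^m`-thickened value sets `{z ∣ ∃ y ∈ M, |(ϖ^m)⁻¹(z − ⟨y, (Γ − 1)y⟩_H)| ≤ 1}` of `M` and `M′` are EQUAL — no plane-dominance, no smallness of the line term.
[cite: Jacobowitz1962, §4] [cite: Rogawski1990, §4.9 Prop. 4.9.1 (b) p. 55] [cite: Kottwitz1986BaseChangeUnits, §1 pp. 240–241] -/
theorem valueSet_endoGL_sub_one_eq_of_inf_ker_eq [IsPrincipalIdealRing 𝒪[K]] (σ : K →+* K) (hσ : ∀ a, σ (σ a) = a)
    (hvσ : ∀ a, Valued.v (σ a) = Valued.v a) {ϖ : K} (hϖ : Valued.v ϖ = WithZero.exp (-1 : ℤ))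
    {H₂ : Matrix (Fin 2) (Fin 2) K} (hH₂ : IsUnit H₂.det) (hH₂σ : (H₂.map σ)ᵀ = H₂) {h : K} (hh : Valued.v h = 1)
    (γ₂ : GL (Fin 2) K) (u : GL (Fin 1) K) {m : ℕ} (hum : Valued.v ((u : Matrix (Fin 1) (Fin 1) K) 0 0 - 1) ≤ Valued.v (ϖ ^ m))
    {M M' : Submodule 𝒪[K] (Fin 3 → K)}
    (hM : IsSelfDualLattice σ ϖ (!![H₂ 0 0, 0, H₂ 0 1; 0, h, 0; H₂ 1 0, 0, H₂ 1 1] : Matrix (Fin 3) (Fin 3) K) M)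
    (hM' : IsSelfDualLattice σ ϖ (!![H₂ 0 0, 0, H₂ 0 1; 0, h, 0; H₂ 1 0, 0, H₂ 1 1] : Matrix (Fin 3) (Fin 3) K) M')
    {b : ℕ} (hb1 : 1 ≤ b) (hb : ∀ c : K, (Pi.single 1 c : Fin 3 → K) ∈ M ↔ Valued.v c ≤ Valued.v ϖ ^ b)
    (hb' : ∀ c : K, (Pi.single 1 c : Fin 3 → K) ∈ M' ↔ Valued.v c ≤ Valued.v ϖ ^ b)
    (hW : M ⊓ LinearMap.ker ((LinearMap.proj (1 : Fin 3) : (Fin 3 → K) →ₗ[K] K).restrictScalars 𝒪[K]) =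
      M' ⊓ LinearMap.ker ((LinearMap.proj (1 : Fin 3) : (Fin 3 → K) →ₗ[K] K).restrictScalars 𝒪[K])) :
    {z : K | ∃ y ∈ M, Valued.v ((ϖ ^ m)⁻¹ * (z - pairing σ (!![H₂ 0 0, 0, H₂ 0 1; 0, h, 0; H₂ 1 0, 0, H₂ 1 1] : Matrix (Fin 3) (Fin 3) K) y ((((endoGL (γ₂, u) : GL (Fin 3) K) : Matrix (Fin 3) (Fin 3) K) - 1) *ᵥ y))) ≤ 1} =
      {z : K | ∃ y ∈ M', Valued.v ((ϖ ^ m)⁻¹ * (z - pairing σ (!![H₂ 0 0, 0, H₂ 0 1; 0, h, 0; H₂ 1 0, 0, H₂ 1 1] : Matrix (Fin 3) (Fin 3) K) y ((((endoGL (γ₂, u) : GL (Fin 3) K) : Matrix (Fin 3) (Fin 3) K) - 1) *ᵥ y))) ≤ 1} := by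
  obtain ⟨B₂, w₀, x₀, -, hB, hx₀, hx₀1, hprx, hG1, hgen, -⟩ := exists_planeGlueData σ hσ hvσ hϖ hH₂ hH₂σ hh hM hb1 hb
  obtain ⟨B₂', w₀', x₀', -, hB', hx₀', hx₀'1, hprx', hG1', hgen', -⟩ := exists_planeGlueData σ hσ hvσ hϖ hH₂ hH₂σ hh hM' hb1 hb'
  have hBB : B₂' = B₂ := Submodule.map_injective_of_injective planeMatrix_injective (by rw [hB', hB, hW])
  subst hBB
  have hpr := forall_v_apply_one_mul_le_of_tube σ hvσ hϖ hH₂ hh hM hb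
  have hpr' := forall_v_apply_one_mul_le_of_tube σ hvσ hϖ hH₂ hh hM' hb'
  obtain ⟨t', a', ht', ha', hw⟩ := exists_related_of_glueData hσ hvσ hH₂σ hG1 hgen'
  obtain ⟨t, a, ht, ha, hw'⟩ := exists_related_of_glueData hσ hvσ hH₂σ hG1' hgen
  exact Set.Subset.antisymm
    (valueSet_endoGL_sub_one_subset_of_related σ hvσ hϖ H₂ h hM hM' hpr hpr' hB hB' hx₀ hx₀1 hprx hx₀' hx₀'1 hprx' ht' ha' hw γ₂ u hum)
    (valueSet_endoGL_sub_one_subset_of_related σ hvσ hϖ H₂ h hM' hM hpr' hpr hB' hB hx₀' hx₀'1 hprx' hx₀ hx₀1 hprx ht ha hw' γ₂ u hum)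

/-! ## §3 HEAD — the `hQ` binders of ★ p860968 for the two `f_{T₊}` predicates -/

/-- **`hQ` FOR THE `T₊` PREDICATE**: near `1` (`|u − 1| ≤ |ϖ^m|`), «shell `(ℓ, m)` of `Γ − 1` ∧ value set `= V`» is fibre-constant on every tube layer `b ≥ 1`, for any reference set `V`
— in ★ p860968 `ncard_fixed_selfDual_endoGL_sep_eq_axis_add_sum`'s `hQ` binder shape VERBATIM (`Q M := LatticeNearTransvShell ϖ ℓ m (Γ − 1) M ∧ {value set} = V`).
[cite: Rogawski1990, §4.9 Prop. 4.9.1 (b) p. 55] [cite: Kottwitz1986BaseChangeUnits, §1 pp. 240–241] [cite: Jacobowitz1962, §4] -/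
theorem hQ_transvPlus_of_v_sub_one_le [IsPrincipalIdealRing 𝒪[K]] (σ : K →+* K) (hσ : ∀ a, σ (σ a) = a)
    (hvσ : ∀ a, Valued.v (σ a) = Valued.v a) {ϖ : K} (hϖ : Valued.v ϖ = WithZero.exp (-1 : ℤ))
    {H₂ : Matrix (Fin 2) (Fin 2) K} (hH₂ : IsUnit H₂.det) (hH₂σ : (H₂.map σ)ᵀ = H₂) {h : K} (hh : Valued.v h = 1)
    (γ₂ : GL (Fin 2) K) (u : GL (Fin 1) K) (ℓ : ℕ) {m : ℕ} (hum : Valued.v ((u : Matrix (Fin 1) (Fin 1) K) 0 0 - 1) ≤ Valued.v (ϖ ^ m)) (V : Set K) :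
    ∀ (b : ℕ), 1 ≤ b → ∀ M M' : Submodule 𝒪[K] (Fin 3 → K),
      IsSelfDualLattice σ ϖ (!![H₂ 0 0, 0, H₂ 0 1; 0, h, 0; H₂ 1 0, 0, H₂ 1 1] : Matrix (Fin 3) (Fin 3) K) M →
      IsSelfDualLattice σ ϖ (!![H₂ 0 0, 0, H₂ 0 1; 0, h, 0; H₂ 1 0, 0, H₂ 1 1] : Matrix (Fin 3) (Fin 3) K) M' →
      (∀ c : K, (Pi.single 1 c : Fin 3 → K) ∈ M ↔ Valued.v c ≤ Valued.v ϖ ^ b) → (∀ c : K, (Pi.single 1 c : Fin 3 → K) ∈ M' ↔ Valued.v c ≤ Valued.v ϖ ^ b) →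
      M ⊓ LinearMap.ker ((LinearMap.proj (1 : Fin 3) : (Fin 3 → K) →ₗ[K] K).restrictScalars 𝒪[K]) =
        M' ⊓ LinearMap.ker ((LinearMap.proj (1 : Fin 3) : (Fin 3 → K) →ₗ[K] K).restrictScalars 𝒪[K]) →
      (LatticeNearTransvShell ϖ ℓ m ((((endoGL (γ₂, u) : GL (Fin 3) K) : Matrix (Fin 3) (Fin 3) K) - 1)) M ∧
        {z : K | ∃ y ∈ M, Valued.v ((ϖ ^ m)⁻¹ * (z - pairing σ (!![H₂ 0 0, 0, H₂ 0 1; 0, h, 0; H₂ 1 0, 0, H₂ 1 1] : Matrix (Fin 3) (Fin 3) K) y ((((endoGL (γ₂, u) : GL (Fin 3) K) : Matrix (Fin 3) (Fin 3) K) - 1) *ᵥ y))) ≤ 1} = V) →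
      (LatticeNearTransvShell ϖ ℓ m ((((endoGL (γ₂, u) : GL (Fin 3) K) : Matrix (Fin 3) (Fin 3) K) - 1)) M' ∧
        {z : K | ∃ y ∈ M', Valued.v ((ϖ ^ m)⁻¹ * (z - pairing σ (!![H₂ 0 0, 0, H₂ 0 1; 0, h, 0; H₂ 1 0, 0, H₂ 1 1] : Matrix (Fin 3) (Fin 3) K) y ((((endoGL (γ₂, u) : GL (Fin 3) K) : Matrix (Fin 3) (Fin 3) K) - 1) *ᵥ y))) ≤ 1} = V) := by
  intro b hb1 M M' hM hM' hb hb' hW hQ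
  refine ⟨(latticeNearTransvShell_iff_of_inf_ker_eq σ hσ hvσ hϖ hH₂ hH₂σ hh γ₂ u ℓ m hM hM' hb1 hb hb' hW).1 hQ.1, ?_⟩
  rw [← valueSet_endoGL_sub_one_eq_of_inf_ker_eq σ hσ hvσ hϖ hH₂ hH₂σ hh γ₂ u hum hM hM' hb1 hb hb' hW]
  exact hQ.2

/-- **`hQ` FOR THE `T−′` PREDICATE**: near `1` (`|u − 1| ≤ |ϖ^m|`), «shell `(ℓ, m_c)` of `Γ − 1` ∧ value set (precision `m`) `≠ V`» is fibre-constant on every tube layer `b ≥ 1`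
(★ p860968's `hQ` binder shape VERBATIM at `Q M := LatticeNearTransvShell ϖ ℓ mc (Γ − 1) M ∧ ¬ {value set} = V`). [cite: Rogawski1990, §4.9 Prop. 4.9.1 (b) p. 55] [cite: Kottwitz1986BaseChangeUnits, §1 pp. 240–241] [cite: Jacobowitz1962, §4] -/
theorem hQ_cleanMinus_of_v_sub_one_le [IsPrincipalIdealRing 𝒪[K]] (σ : K →+* K) (hσ : ∀ a, σ (σ a) = a)
    (hvσ : ∀ a, Valued.v (σ a) = Valued.v a) {ϖ : K} (hϖ : Valued.v ϖ = WithZero.exp (-1 : ℤ))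
    {H₂ : Matrix (Fin 2) (Fin 2) K} (hH₂ : IsUnit H₂.det) (hH₂σ : (H₂.map σ)ᵀ = H₂) {h : K} (hh : Valued.v h = 1)
    (γ₂ : GL (Fin 2) K) (u : GL (Fin 1) K) (ℓ mc : ℕ) {m : ℕ} (hum : Valued.v ((u : Matrix (Fin 1) (Fin 1) K) 0 0 - 1) ≤ Valued.v (ϖ ^ m)) (V : Set K) :
    ∀ (b : ℕ), 1 ≤ b → ∀ M M' : Submodule 𝒪[K] (Fin 3 → K),
      IsSelfDualLattice σ ϖ (!![H₂ 0 0, 0, H₂ 0 1; 0, h, 0; H₂ 1 0, 0, H₂ 1 1] : Matrix (Fin 3) (Fin 3) K) M →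
      IsSelfDualLattice σ ϖ (!![H₂ 0 0, 0, H₂ 0 1; 0, h, 0; H₂ 1 0, 0, H₂ 1 1] : Matrix (Fin 3) (Fin 3) K) M' →
      (∀ c : K, (Pi.single 1 c : Fin 3 → K) ∈ M ↔ Valued.v c ≤ Valued.v ϖ ^ b) → (∀ c : K, (Pi.single 1 c : Fin 3 → K) ∈ M' ↔ Valued.v c ≤ Valued.v ϖ ^ b) →
      M ⊓ LinearMap.ker ((LinearMap.proj (1 : Fin 3) : (Fin 3 → K) →ₗ[K] K).restrictScalars 𝒪[K]) =
        M' ⊓ LinearMap.ker ((LinearMap.proj (1 : Fin 3) : (Fin 3 → K) →ₗ[K] K).restrictScalars 𝒪[K]) →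
      (LatticeNearTransvShell ϖ ℓ mc ((((endoGL (γ₂, u) : GL (Fin 3) K) : Matrix (Fin 3) (Fin 3) K) - 1)) M ∧
        ¬ {z : K | ∃ y ∈ M, Valued.v ((ϖ ^ m)⁻¹ * (z - pairing σ (!![H₂ 0 0, 0, H₂ 0 1; 0, h, 0; H₂ 1 0, 0, H₂ 1 1] : Matrix (Fin 3) (Fin 3) K) y ((((endoGL (γ₂, u) : GL (Fin 3) K) : Matrix (Fin 3) (Fin 3) K) - 1) *ᵥ y))) ≤ 1} = V) →
      (LatticeNearTransvShell ϖ ℓ mc ((((endoGL (γ₂, u) : GL (Fin 3) K) : Matrix (Fin 3) (Fin 3) K) - 1)) M' ∧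
        ¬ {z : K | ∃ y ∈ M', Valued.v ((ϖ ^ m)⁻¹ * (z - pairing σ (!![H₂ 0 0, 0, H₂ 0 1; 0, h, 0; H₂ 1 0, 0, H₂ 1 1] : Matrix (Fin 3) (Fin 3) K) y ((((endoGL (γ₂, u) : GL (Fin 3) K) : Matrix (Fin 3) (Fin 3) K) - 1) *ᵥ y))) ≤ 1} = V) := by
  intro b hb1 M M' hM hM' hb hb' hW hQ
  refine ⟨(latticeNearTransvShell_iff_of_inf_ker_eq σ hσ hvσ hϖ hH₂ hH₂σ hh γ₂ u ℓ mc hM hM' hb1 hb hb' hW).1 hQ.1, ?_⟩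
  rw [← valueSet_endoGL_sub_one_eq_of_inf_ker_eq σ hσ hvσ hϖ hH₂ hH₂σ hh γ₂ u hum hM hM' hb1 hb hb' hW]
  exact hQ.2

end Summit.HodgeConjecture.HodgeConjecture.Cruxes.H413.F0P3cDyRamBlockGlueLabelFibreConstant

end
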